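import Literature.NumberTheory.Automorphic.SLTwoTreeQuadraticTorusShellOrbit   -- ★ part V-a (A-p17 (g23), R1LL-WILD (W′1)): `TK`, `TK(m)`, `exists_equiv_quotient_torusInt_orbit`, `ncard_torusInt_orbit_eq_relIndex`
import HarnessLib

/-!
# The non-split quadratic torus on the tree of `SL₂(F)`, V-b: at a RAMIFIED place the shell `m` is the disjoint union of two `TK`-orbits, so
# `#{x | d x = m} = 2 · [TK : TK(m)]` (Labesse–Langlands 1979, §2 p. 8: `δ_m = 2q^m` «if L is ramified»)

Topic `NumberTheory/Automorphic`; namespace `Literature.NumberTheory.Automorphic.HermitianLatticeTree` (ROAD W's).  KERNEL mathematics only: theorems, no definition, no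
named fact, no instance, no notation, no `sorry`.  Cell `pub/hodgecm-mathlib` (D-0151), crux H413 = `stmt-HodgeConjecture-24833`, line «N6nsGerm», road «W′» = «R1LL-WILD»
(LEAD F0P3a-plan (g10) WORD T9-25; architect A-p16 (g28), RULINGS A-38 (c) ∕ A-40 (a) ∕ «SPLIT» 11:43Z: brick (W′1)-V «SHELL CARDINALITIES» = (V-ORBIT) A-p17 (g23) [part V-a
★ `SLTwoTreeQuadraticTorusShellOrbit` + THIS file] ∥ (V-INDEX) A-p01 (g21) [`relindex_torusInt_shellStab_eq : TK(m).relIndex TK = q^m` under the Eisenstein hypotheses]).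
Census `A-provers/A-p17/g23/CENSUS-W1prime-V-ShellCardinalities.A-p17g23.md`.  Parts I–IV = ★ p843889 ∕ p843931 ∕ p843948 ∕ p843967.
HONEST LABEL: HC_CM is proved only modulo the cell's 2 remaining named inputs (hLiu418, h413) until rung 0 closes; nothing printed is asserted here — elementary lattice and
group bookkeeping over a discrete valuation ring.

THE MATHEMATICS (notation of parts I–V-a: `TK = centralizer {γτ} ⊓ GL₂(𝒪)` the integral torus, `TK(m) = TK ⊓ (GL₂(𝒪)).map (conj (r m))` the stabiliser of `x_m = r m · v₀`,
`r m = diag(1, ϖ^m)`, `d` the shell index of ★ III, `hE` the non-split ∕ integral-basis binder, `u v ∈ 𝒪`).  At a RAMIFIED place the torus contains an element `π` with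
`|det π| = |ϖ|` (a uniformiser of `E = F(τ)`).
* §15 `exists_torusInt_glVertexAct_eq_or`: every torus element acts on the vertices like some `t₀ ∈ TK` or like `π t₀` (divide by `ϖ^{⌊ord det ∕ 2⌋}` — scalars act
  trivially — and by `π` if the order is odd; integrality of the quotient IS `hE`).  `TK` preserves the vertex type, `π` swaps it (★ `SLTwoTreeProjectiveActionAdj`, ★
  `not_isModularLattice_of_isSelfDualLattice`).  Hence **`{x | d x = m} = TK · x_m ∪ π · (TK · x_m)`**, a DISJOINT union of two equinumerous sets
  (`setOf_shellIndex_eq_eq_union`, `disjoint_torusInt_orbit_image`, `glVertexAct_injective`), and with ★ V-a `ncard_torusInt_orbit_eq_relIndex`: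
  **`{x | d x = m}.ncard = 2 * TK(m).relIndex TK`** and `{x | d x = m}.Finite` whenever the index is non-zero (`ncard_setOf_shellIndex_eq_two_mul_relIndex`) — with
  (V-INDEX)'s `q^m` this is LL's **`δ_m = 2q^m`**; and the COEFFICIENTS + `hfin` of B-p14 (g33)'s ★ shell sum p843939: for a unit `γ = a + bτ`, `|b| = |ϖ|^n`,
  **`#{x | γ · x = x ∧ d x = i} = if i ≤ n then 2 * TK(i).relIndex TK else 0`** and `{x | γ · x = x}.Finite` (`ncard_setOf_glVertexAct_torus_eq_self_sep_shellIndex`).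
NOT here: the value of the index ((V-INDEX) A-p01 (g21)); the unramified twin (one orbit, `δ_m = (q+1)q^{m−1}`; not needed on road W′).

## References
* [LabesseLanglands1979] J.-P. Labesse, R. P. Langlands, *L-indistinguishability for SL(2)*, Canad. J. Math. 31 (1979), §2 p. 8 (`δ_m = 2q^m` if `L` is ramified).
* [Serre1980Trees] J.-P. Serre, *Trees* (1980), Ch. I §6.1, Ch. II §1.1–§1.3 (two vertex types; `GL₂` acts with inversions).
-/

set_option autoImplicit false

noncomputable section

open scoped ValuativeRel Matrix MatrixGroups
open Matrix ValuativeRel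

namespace Literature.NumberTheory.Automorphic.HermitianLatticeTree

open Literature.NumberTheory.Automorphic Literature.NumberTheory.LocalFields

variable {F : Type*} [Field F] [ValuativeRel F] {ϖ : F} (hϖ : IsUniformizingElement ϖ) [IsDiscreteValuationRing 𝒪[F]]

/-! ## §15 At a ramified place the shell is two `TK`-orbits: `{x | d x = m} = TK · x_m ⊔ π · (TK · x_m)` -/

include hϖ in
/-- **NORMALISING A TORUS ELEMENT** (under the non-split hypothesis `hE`): given ONE torus element `π` with `|det π| = |ϖ|` (a uniformiser of `E` — the place is RAMIFIED),
every torus element `t ∈ GL₂(F)` acts on the vertices either like an INTEGRAL UNIT-NORM torus element `t₀ ∈ TK` or like `π · t₀` with `t₀ ∈ TK`: divide by the scalar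
`ϖ^{⌊ord(det t)∕2⌋}` (scalars act trivially, ★ `glVertexAct_scalar_mul`) and, if `ord(det t)` is odd, by `π`; integrality of the quotient IS `hE`.
[cite: LabesseLanglands1979, §2 p. 8] -/
theorem exists_torusInt_glVertexAct_eq_or {u v : F} (hu : u ∈ 𝒪[F]) (hv : v ∈ 𝒪[F])
    (hE : ∀ p q : F, valuation F (p ^ 2 + p * q * u - q ^ 2 * v) ≤ 1 → p ∈ 𝒪[F] ∧ q ∈ 𝒪[F])
    {γτ : GL (Fin 2) F} (hγτ : (γτ : Matrix (Fin 2) (Fin 2) F) = !![0, v; 1, u])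
    {π : GL (Fin 2) F} (hπ : π ∈ Subgroup.centralizer ({γτ} : Set (GL (Fin 2) F))) (hπdet : valuation F (π : Matrix (Fin 2) (Fin 2) F).det = valuation F ϖ)
    {t : GL (Fin 2) F} (ht : t ∈ Subgroup.centralizer ({γτ} : Set (GL (Fin 2) F))) :
    ∃ t₀ ∈ Subgroup.centralizer ({γτ} : Set (GL (Fin 2) F)) ⊓ glInt 2 F,
      (∀ x, glVertexAct hϖ t x = glVertexAct hϖ t₀ x) ∨ (∀ x, glVertexAct hϖ t x = glVertexAct hϖ (π * t₀) x) := by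
  have h0 := hϖ.ne_zero
  have hv0 : valuation F ϖ ≠ 0 := (Valuation.ne_zero_iff _).2 h0
  -- membership in `TK` from the centraliser and the determinant, via `hE`
  have key : ∀ s : GL (Fin 2) F, s ∈ Subgroup.centralizer ({γτ} : Set (GL (Fin 2) F)) → valuation F (s : Matrix (Fin 2) (Fin 2) F).det = 1 →
      s ∈ Subgroup.centralizer ({γτ} : Set (GL (Fin 2) F)) ⊓ glInt 2 F := by
    intro s hs hsdet
    obtain ⟨c, e, hse⟩ := (mem_centralizer_companion_iff hγτ s).1 hs
    have hN : valuation F (c ^ 2 + c * e * u - e ^ 2 * v) ≤ 1 := by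
      rw [← QuadraticRegularRep.det_regRep u v c e, ← hse, hsdet]
    obtain ⟨hc, he⟩ := hE c e hN
    exact (mem_centralizer_inf_glInt_iff hu hv hγτ s).2 ⟨c, e, hc, he, hse, hsdet⟩
  -- `det t = ϖ^k w`, `k = 2 j + ε`
  have hdet0 : (t : Matrix (Fin 2) (Fin 2) F).det ≠ 0 := (t.isUnit.map Matrix.detMonoidHom).ne_zero
  obtain ⟨k, w, hw, hk⟩ := exists_eq_zpow_mul_of_ne_zero hϖ hdet0
  set cm : Fˣ := (Units.mk0 ϖ h0) ^ (-(k / 2)) with hcm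
  set t' : GL (Fin 2) F := cm.map ((Matrix.scalar (Fin 2) : F →+* Matrix (Fin 2) (Fin 2) F) : F →* Matrix (Fin 2) (Fin 2) F) * t with ht'
  have hcmcoe : ((cm.map ((Matrix.scalar (Fin 2) : F →+* Matrix (Fin 2) (Fin 2) F) : F →* Matrix (Fin 2) (Fin 2) F) : GL (Fin 2) F) : Matrix (Fin 2) (Fin 2) F) =
      ϖ ^ (-(k / 2)) • (1 : Matrix (Fin 2) (Fin 2) F) := by
    rw [Units.coe_map, MonoidHom.coe_coe, Matrix.scalar_apply, ← Matrix.smul_one_eq_diagonal, hcm, Units.val_zpow_eq_zpow_val, Units.val_mk0]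
  have ht'act : ∀ x, glVertexAct hϖ t x = glVertexAct hϖ t' x := fun x => (glVertexAct_scalar_mul hϖ cm t x).symm
  have ht'cen : t' ∈ Subgroup.centralizer ({γτ} : Set (GL (Fin 2) F)) := by
    refine mul_mem ?_ ht
    rw [Subgroup.mem_centralizer_singleton_iff]
    ext : 1
    rw [Units.val_mul, Units.val_mul, hcmcoe, Matrix.smul_mul, Matrix.mul_smul, Matrix.one_mul, Matrix.mul_one]
  have ht'det : valuation F (t' : Matrix (Fin 2) (Fin 2) F).det = valuation F ϖ ^ (k % 2) := by
    rw [ht', Units.val_mul, Matrix.det_mul, hcmcoe, Matrix.det_smul, Matrix.det_one, mul_one, Fintype.card_fin, hk, map_mul, map_mul, map_pow,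
      map_zpow₀, map_zpow₀, hw, mul_one, ← zpow_natCast, ← _root_.zpow_mul, ← zpow_add₀ hv0]
    congr 1
    push_cast
    omega
  rcases Int.emod_two_eq_zero_or_one k with hε | hε
  · -- even: `t'` itself is integral of unit norm
    rw [hε, zpow_zero] at ht'det
    exact ⟨t', key t' ht'cen ht'det, Or.inl ht'act⟩
  · -- odd: `π⁻¹ t'` is integral of unit norm
    rw [hε, zpow_one] at ht'det
    refine ⟨π⁻¹ * t', key _ (mul_mem (inv_mem hπ) ht'cen) ?_, Or.inr fun x => ?_⟩
    · rw [Units.val_mul, Matrix.det_mul, map_mul, Matrix.coe_units_inv, Matrix.det_nonsing_inv, Ring.inverse_eq_inv', map_inv₀, hπdet, ht'det,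
        inv_mul_cancel₀ hv0]
    · rw [mul_inv_cancel_left, ht'act]

include hϖ in
/-- **Elements of `TK` preserve the vertex type** (`|det| = 1`): `t · y` is self-dual iff `y` is. [cite: Serre1980Trees, Ch. II §1.2] -/
theorem isSelfDualLattice_glVertexAct_iff_of_valuation_det_eq_one {t : GL (Fin 2) F} (ht : valuation F (t : Matrix (Fin 2) (Fin 2) F).det = 1)
    (y : {M : Submodule 𝒪[F] (Fin 2 → F) // IsSpecialLattice (RingHom.id F) ϖ !![(0 : F), 1; -1, 0] M}) :
    IsSelfDualLattice (RingHom.id F) !![(0 : F), 1; -1, 0] (glVertexAct hϖ t y).1 ↔ IsSelfDualLattice (RingHom.id F) !![(0 : F), 1; -1, 0] y.1 := by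
  rw [glVertexAct_coe_of_valuation_det_eq_one hϖ ht]
  constructor
  · intro h
    rcases y.2 with hy | hy
    · exact hy
    · exact absurd (isModularLattice_mapGL_of_valuation_det_eq_one hϖ.ne_zero ht hy) (not_isModularLattice_of_isSelfDualLattice (RingHom.id F) (fun _ => rfl) hϖ _ h)
  · exact isSelfDualLattice_mapGL_of_valuation_det_eq_one ht

include hϖ in
/-- **An element with `|det π| = |ϖ|` swaps the vertex type**: `π · y` is self-dual iff `y` is NOT. [cite: Serre1980Trees, Ch. II §1.2–§1.3] -/
theorem isSelfDualLattice_glVertexAct_iff_not_of_valuation_det_eq {π : GL (Fin 2) F} (hπ : valuation F (π : Matrix (Fin 2) (Fin 2) F).det = valuation F ϖ)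
    (y : {M : Submodule 𝒪[F] (Fin 2 → F) // IsSpecialLattice (RingHom.id F) ϖ !![(0 : F), 1; -1, 0] M}) :
    IsSelfDualLattice (RingHom.id F) !![(0 : F), 1; -1, 0] (glVertexAct hϖ π y).1 ↔ ¬ IsSelfDualLattice (RingHom.id F) !![(0 : F), 1; -1, 0] y.1 := by
  have h0 := hϖ.ne_zero
  rcases y.2 with hy | hy
  · rw [glVertexAct_coe_of_valuation_det_eq_of_isSelfDual hϖ hπ y hy]
    have hmod := isModularLattice_mapGL_of_valuation_det_eq h0 hπ hy
    exact ⟨fun h => absurd hmod (fun hm => not_isModularLattice_of_isSelfDualLattice (RingHom.id F) (fun _ => rfl) hϖ _ h hm), fun h => absurd hy h⟩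
  · rw [glVertexAct_coe_of_valuation_det_eq_of_isModular hϖ hπ y hy]
    have hsd := isSelfDualLattice_scaleLattice_inv_mapGL_of_valuation_det_eq h0 hπ hy
    exact ⟨fun _ h => not_isModularLattice_of_isSelfDualLattice (RingHom.id F) (fun _ => rfl) hϖ _ h hy, fun _ => hsd⟩

include hϖ in
/-- `glVertexAct hϖ g` is injective (it is invertible). [cite: Serre1980Trees, Ch. II §1.2] -/
theorem glVertexAct_injective (g : GL (Fin 2) F) :
    Function.Injective (glVertexAct hϖ g : {M : Submodule 𝒪[F] (Fin 2 → F) // IsSpecialLattice (RingHom.id F) ϖ !![(0 : F), 1; -1, 0] M} → _) := by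
  intro x y h
  have h' := congrArg (glVertexAct hϖ g⁻¹) h
  rwa [← glVertexAct_mul, ← glVertexAct_mul, inv_mul_cancel, glVertexAct_one, glVertexAct_one] at h'

include hϖ in
/-- **THE SHELL IS THE UNION OF THE TWO `TK`-ORBITS** `TK · x_m` and `π · (TK · x_m)` (ramified: `π` a torus element with `|det π| = |ϖ|`; `d` the shell index of ★ III,
both properties). [cite: LabesseLanglands1979, §2 p. 8] -/
theorem setOf_shellIndex_eq_eq_union {u v : F} (hu : u ∈ 𝒪[F]) (hv : v ∈ 𝒪[F])
    (hE : ∀ p q : F, valuation F (p ^ 2 + p * q * u - q ^ 2 * v) ≤ 1 → p ∈ 𝒪[F] ∧ q ∈ 𝒪[F])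
    {γτ : GL (Fin 2) F} (hγτ : (γτ : Matrix (Fin 2) (Fin 2) F) = !![0, v; 1, u])
    {π : GL (Fin 2) F} (hπ : π ∈ Subgroup.centralizer ({γτ} : Set (GL (Fin 2) F))) (hπdet : valuation F (π : Matrix (Fin 2) (Fin 2) F).det = valuation F ϖ)
    {r : ℕ → GL (Fin 2) F} (hr : ∀ m, (r m : Matrix (Fin 2) (Fin 2) F) = Matrix.diagonal ![1, ϖ ^ m])
    (v₀ : {M : Submodule 𝒪[F] (Fin 2 → F) // IsSpecialLattice (RingHom.id F) ϖ !![(0 : F), 1; -1, 0] M})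
    {d : {M : Submodule 𝒪[F] (Fin 2 → F) // IsSpecialLattice (RingHom.id F) ϖ !![(0 : F), 1; -1, 0] M} → ℕ}
    (hd : ∀ x, ∃ (t gm : GL (Fin 2) F) (c e : F), (t : Matrix (Fin 2) (Fin 2) F) = !![c, e * v; e, c + e * u] ∧
      (gm : Matrix (Fin 2) (Fin 2) F) = Matrix.diagonal ![1, ϖ ^ d x] ∧ x = glVertexAct hϖ (t * gm) v₀)
    (hd' : ∀ (x) (t gm : GL (Fin 2) F) (c e : F) (m : ℕ), (t : Matrix (Fin 2) (Fin 2) F) = !![c, e * v; e, c + e * u] →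
      (gm : Matrix (Fin 2) (Fin 2) F) = Matrix.diagonal ![1, ϖ ^ m] → x = glVertexAct hϖ (t * gm) v₀ → d x = m) (m : ℕ) :
    {x | d x = m} =
      {x | ∃ t ∈ Subgroup.centralizer ({γτ} : Set (GL (Fin 2) F)) ⊓ glInt 2 F, glVertexAct hϖ (t * r m) v₀ = x} ∪
        glVertexAct hϖ π '' {x | ∃ t ∈ Subgroup.centralizer ({γτ} : Set (GL (Fin 2) F)) ⊓ glInt 2 F, glVertexAct hϖ (t * r m) v₀ = x} := by
  ext x
  simp only [Set.mem_setOf_eq, Set.mem_union, Set.mem_image]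
  constructor
  · intro hx
    obtain ⟨t, gm, c, e, ht, hgm, hxe⟩ := hd x
    have hgm' : gm = r m := Units.ext (by rw [hgm, hr, hx])
    have htcen : t ∈ Subgroup.centralizer ({γτ} : Set (GL (Fin 2) F)) := (mem_centralizer_companion_iff hγτ t).2 ⟨c, e, ht⟩
    obtain ⟨t₀, ht₀, h | h⟩ := exists_torusInt_glVertexAct_eq_or hϖ hu hv hE hγτ hπ hπdet htcen
    · left
      exact ⟨t₀, ht₀, by rw [glVertexAct_mul, ← h, ← glVertexAct_mul, ← hgm', ← hxe]⟩
    · right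
      refine ⟨glVertexAct hϖ (t₀ * r m) v₀, ⟨t₀, ht₀, rfl⟩, ?_⟩
      rw [glVertexAct_mul, ← glVertexAct_mul hϖ π, ← h, ← glVertexAct_mul, ← hgm', ← hxe]
  · rintro (⟨t, ht, rfl⟩ | ⟨y, ⟨t, ht, rfl⟩, rfl⟩)
    · obtain ⟨c, e, htce⟩ := (mem_centralizer_companion_iff hγτ t).1 (Subgroup.mem_inf.1 ht).1
      exact hd' _ t (r m) c e m htce (hr m) rfl
    · have hπt : π * t ∈ Subgroup.centralizer ({γτ} : Set (GL (Fin 2) F)) := mul_mem hπ (Subgroup.mem_inf.1 ht).1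
      obtain ⟨c, e, htce⟩ := (mem_centralizer_companion_iff hγτ (π * t)).1 hπt
      exact hd' _ (π * t) (r m) c e m htce (hr m) (by simp only [glVertexAct_mul])

include hϖ in
/-- **THE TWO ORBITS ARE DISJOINT**: `TK · x_m` consists of vertices of the type of `x_m`, `π · (TK · x_m)` of the other type. [cite: Serre1980Trees, Ch. II §1.2–§1.3] -/
theorem disjoint_torusInt_orbit_image {γτ : GL (Fin 2) F}
    {π : GL (Fin 2) F} (hπdet : valuation F (π : Matrix (Fin 2) (Fin 2) F).det = valuation F ϖ) (rm : GL (Fin 2) F)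
    (v₀ : {M : Submodule 𝒪[F] (Fin 2 → F) // IsSpecialLattice (RingHom.id F) ϖ !![(0 : F), 1; -1, 0] M}) :
    Disjoint {x | ∃ t ∈ Subgroup.centralizer ({γτ} : Set (GL (Fin 2) F)) ⊓ glInt 2 F, glVertexAct hϖ (t * rm) v₀ = x}
      (glVertexAct hϖ π '' {x | ∃ t ∈ Subgroup.centralizer ({γτ} : Set (GL (Fin 2) F)) ⊓ glInt 2 F, glVertexAct hϖ (t * rm) v₀ = x}) := by
  rw [Set.disjoint_left]
  rintro x ⟨t, ht, rfl⟩ ⟨y, ⟨t', ht', rfl⟩, hxy⟩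
  have htd := valuation_det_eq_one_of_mem_glInt (Subgroup.mem_inf.1 ht).2
  have ht'd := valuation_det_eq_one_of_mem_glInt (Subgroup.mem_inf.1 ht').2
  -- type of `t · x_m` = type of `x_m` = type of `t' · x_m` ≠ type of `π · (t' · x_m)`
  have h1 := isSelfDualLattice_glVertexAct_iff_of_valuation_det_eq_one hϖ htd (glVertexAct hϖ rm v₀)
  have h2 := isSelfDualLattice_glVertexAct_iff_of_valuation_det_eq_one hϖ ht'd (glVertexAct hϖ rm v₀)
  have h3 := isSelfDualLattice_glVertexAct_iff_not_of_valuation_det_eq hϖ hπdet (glVertexAct hϖ (t' * rm) v₀)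
  rw [hxy, glVertexAct_mul, glVertexAct_mul, h1, h2] at h3
  exact iff_not_self h3

include hϖ in
/-- **THE SHELL COUNT AT A RAMIFIED PLACE**: `#{x | d x = m} = 2 · [TK : TK(m)]` whenever the index is finite (then the shell is finite) — with (V-INDEX)'s
`[TK : TK(m)] = q^m` (A-p01 (g21)) this is Labesse–Langlands' **`δ_m = 2q^m`**. [cite: LabesseLanglands1979, §2 p. 8] -/
theorem ncard_setOf_shellIndex_eq_two_mul_relIndex {u v : F} (hu : u ∈ 𝒪[F]) (hv : v ∈ 𝒪[F])
    (hE : ∀ p q : F, valuation F (p ^ 2 + p * q * u - q ^ 2 * v) ≤ 1 → p ∈ 𝒪[F] ∧ q ∈ 𝒪[F])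
    {γτ : GL (Fin 2) F} (hγτ : (γτ : Matrix (Fin 2) (Fin 2) F) = !![0, v; 1, u])
    {π : GL (Fin 2) F} (hπ : π ∈ Subgroup.centralizer ({γτ} : Set (GL (Fin 2) F))) (hπdet : valuation F (π : Matrix (Fin 2) (Fin 2) F).det = valuation F ϖ)
    {r : ℕ → GL (Fin 2) F} (hr : ∀ m, (r m : Matrix (Fin 2) (Fin 2) F) = Matrix.diagonal ![1, ϖ ^ m])
    (v₀ : {M : Submodule 𝒪[F] (Fin 2 → F) // IsSpecialLattice (RingHom.id F) ϖ !![(0 : F), 1; -1, 0] M})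
    (hv₀ : v₀.1 = latt (1 : Matrix (Fin 2) (Fin 2) F))
    {d : {M : Submodule 𝒪[F] (Fin 2 → F) // IsSpecialLattice (RingHom.id F) ϖ !![(0 : F), 1; -1, 0] M} → ℕ}
    (hd : ∀ x, ∃ (t gm : GL (Fin 2) F) (c e : F), (t : Matrix (Fin 2) (Fin 2) F) = !![c, e * v; e, c + e * u] ∧
      (gm : Matrix (Fin 2) (Fin 2) F) = Matrix.diagonal ![1, ϖ ^ d x] ∧ x = glVertexAct hϖ (t * gm) v₀)
    (hd' : ∀ (x) (t gm : GL (Fin 2) F) (c e : F) (m : ℕ), (t : Matrix (Fin 2) (Fin 2) F) = !![c, e * v; e, c + e * u] →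
      (gm : Matrix (Fin 2) (Fin 2) F) = Matrix.diagonal ![1, ϖ ^ m] → x = glVertexAct hϖ (t * gm) v₀ → d x = m) (m : ℕ)
    (hidx : (Subgroup.centralizer ({γτ} : Set (GL (Fin 2) F)) ⊓ glInt 2 F ⊓ (glInt 2 F).map (MulAut.conj (r m)).toMonoidHom).relIndex
      (Subgroup.centralizer ({γτ} : Set (GL (Fin 2) F)) ⊓ glInt 2 F) ≠ 0) :
    {x | d x = m}.Finite ∧ {x | d x = m}.ncard =
      2 * (Subgroup.centralizer ({γτ} : Set (GL (Fin 2) F)) ⊓ glInt 2 F ⊓ (glInt 2 F).map (MulAut.conj (r m)).toMonoidHom).relIndex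
        (Subgroup.centralizer ({γτ} : Set (GL (Fin 2) F)) ⊓ glInt 2 F) := by
  have hS := ncard_torusInt_orbit_eq_relIndex hϖ (r m) v₀ hv₀ (γτ := γτ)
  have hSfin : {x | ∃ t ∈ Subgroup.centralizer ({γτ} : Set (GL (Fin 2) F)) ⊓ glInt 2 F, glVertexAct hϖ (t * r m) v₀ = x}.Finite :=
    Set.finite_of_ncard_ne_zero (by rw [hS]; exact hidx)
  have hunion := setOf_shellIndex_eq_eq_union hϖ hu hv hE hγτ hπ hπdet hr v₀ hd hd' m
  refine ⟨?_, ?_⟩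
  · rw [hunion]; exact hSfin.union (hSfin.image _)
  · rw [hunion, Set.ncard_union_eq (disjoint_torusInt_orbit_image hϖ hπdet (r m) v₀) hSfin (hSfin.image _),
      Set.ncard_image_of_injective _ (glVertexAct_injective hϖ π), hS, two_mul]

include hϖ in
/-- **THE COEFFICIENTS OF THE SHELL SUM AND ITS `hfin`** (for B-p14 (g33)'s ★ `FixedPointsShellValueLaw`): for a unit `γ = a + bτ` with `|b| = |ϖ|^n`,
`#{x | γ · x = x ∧ d x = i} = 2 · [TK : TK(i)]` for `i ≤ n` and `0` for `i > n`, and `{x | γ · x = x}` is finite (indices finite).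
[cite: LabesseLanglands1979, §2 p. 8] -/
theorem ncard_setOf_glVertexAct_torus_eq_self_sep_shellIndex {u v a b : F} (hu : u ∈ 𝒪[F]) (hv : v ∈ 𝒪[F]) (ha : a ∈ 𝒪[F]) (hb : b ∈ 𝒪[F])
    (hE : ∀ p q : F, valuation F (p ^ 2 + p * q * u - q ^ 2 * v) ≤ 1 → p ∈ 𝒪[F] ∧ q ∈ 𝒪[F]) {n : ℕ} (hbn : valuation F b = valuation F ϖ ^ n)
    {γ : GL (Fin 2) F} (hγ : (γ : Matrix (Fin 2) (Fin 2) F) = !![a, b * v; b, a + b * u]) (hγdet : valuation F (γ : Matrix (Fin 2) (Fin 2) F).det = 1)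
    {γτ : GL (Fin 2) F} (hγτ : (γτ : Matrix (Fin 2) (Fin 2) F) = !![0, v; 1, u])
    {π : GL (Fin 2) F} (hπ : π ∈ Subgroup.centralizer ({γτ} : Set (GL (Fin 2) F))) (hπdet : valuation F (π : Matrix (Fin 2) (Fin 2) F).det = valuation F ϖ)
    {r : ℕ → GL (Fin 2) F} (hr : ∀ m, (r m : Matrix (Fin 2) (Fin 2) F) = Matrix.diagonal ![1, ϖ ^ m])
    (v₀ : {M : Submodule 𝒪[F] (Fin 2 → F) // IsSpecialLattice (RingHom.id F) ϖ !![(0 : F), 1; -1, 0] M})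
    (hv₀ : v₀.1 = latt (1 : Matrix (Fin 2) (Fin 2) F))
    {d : {M : Submodule 𝒪[F] (Fin 2 → F) // IsSpecialLattice (RingHom.id F) ϖ !![(0 : F), 1; -1, 0] M} → ℕ}
    (hd : ∀ x, ∃ (t gm : GL (Fin 2) F) (c e : F), (t : Matrix (Fin 2) (Fin 2) F) = !![c, e * v; e, c + e * u] ∧
      (gm : Matrix (Fin 2) (Fin 2) F) = Matrix.diagonal ![1, ϖ ^ d x] ∧ x = glVertexAct hϖ (t * gm) v₀)
    (hd' : ∀ (x) (t gm : GL (Fin 2) F) (c e : F) (m : ℕ), (t : Matrix (Fin 2) (Fin 2) F) = !![c, e * v; e, c + e * u] →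
      (gm : Matrix (Fin 2) (Fin 2) F) = Matrix.diagonal ![1, ϖ ^ m] → x = glVertexAct hϖ (t * gm) v₀ → d x = m)
    (hidx : ∀ i ≤ n, (Subgroup.centralizer ({γτ} : Set (GL (Fin 2) F)) ⊓ glInt 2 F ⊓ (glInt 2 F).map (MulAut.conj (r i)).toMonoidHom).relIndex
      (Subgroup.centralizer ({γτ} : Set (GL (Fin 2) F)) ⊓ glInt 2 F) ≠ 0) :
    {x | glVertexAct hϖ γ x = x}.Finite ∧ ∀ i, {x | glVertexAct hϖ γ x = x ∧ d x = i}.ncard =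
      if i ≤ n then 2 * (Subgroup.centralizer ({γτ} : Set (GL (Fin 2) F)) ⊓ glInt 2 F ⊓ (glInt 2 F).map (MulAut.conj (r i)).toMonoidHom).relIndex
        (Subgroup.centralizer ({γτ} : Set (GL (Fin 2) F)) ⊓ glInt 2 F) else 0 := by
  refine ⟨?_, fun i => ?_⟩
  · -- `Fix(γ) = ⋃_{i ≤ n} shell i`, each finite
    have hsub : {x | glVertexAct hϖ γ x = x} ⊆ ⋃ i ∈ Finset.range (n + 1), {x | d x = i} := by
      intro x hx
      have hle := shellIndex_le_of_glVertexAct_torus_eq_self hϖ hu hv ha hb hbn hγ hγdet v₀ hv₀ hd x hx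
      simp only [Set.mem_iUnion, Finset.mem_range, Set.mem_setOf_eq]
      exact ⟨d x, Nat.lt_succ_of_le hle, rfl⟩
    refine Set.Finite.subset (Set.Finite.biUnion (Finset.finite_toSet _) fun i hi => ?_) hsub
    exact (ncard_setOf_shellIndex_eq_two_mul_relIndex hϖ hu hv hE hγτ hπ hπdet hr v₀ hv₀ hd hd' i
      (hidx i (Nat.le_of_lt_succ (Finset.mem_range.1 hi)))).1
  · rw [setOf_glVertexAct_torus_eq_self_sep_shellIndex_eq hϖ hu hv ha hb hbn hγ hγdet v₀ hv₀ hd i]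
    split_ifs with hi
    · exact (ncard_setOf_shellIndex_eq_two_mul_relIndex hϖ hu hv hE hγτ hπ hπdet hr v₀ hv₀ hd hd' i (hidx i hi)).2
    · exact Set.ncard_empty _

end Literature.NumberTheory.Automorphic.HermitianLatticeTree

end
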